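import Summits.BirchSwinnertonDyer.BirchSwinnertonDyer.Theorems.KolyvaginDepthDoorDepthTableKuriharaDecisiveTriple18562c1p7
import Literature.NumberTheory.EllipticCurves.ShaPTorsionVanishingHigherRank
import Literature.NumberTheory.EllipticCurves.ComplexMultiplicationNotSemistable
import Literature.NumberTheory.EllipticCurves.BurungaleSkinner2023.Curve14a1TwistsCertificate
import Summits.BirchSwinnertonDyer.BirchSwinnertonDyer.Theorems.KolyvaginDepthDoorDepthTableKuriharaDecisiveTriple18562c1SteinWuthrich
import HarnessLib

/-!
# Route `KolyvaginDepthDoor`, crux `KolyvaginDepthSupplyKN` (stmt-BirchSwinnertonDyer-22820) —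
# DEPTH TABLE v23, RANK THREE: THE TWO DOORS AGREE AT `18562c1` @ `7`, BY NAME — Stein–Wuthrich 2013 Thm. 1.1 (the
# cyclotomic λ-door: `Ш(18562c1/ℚ)[7] = 0`) and Sakamoto 2022 (the Kurihara door at the decisive triple) PREDICT the tree's
# kit record: `δ̃_{43·127·239}(18562c1)` is a `7`-adic unit (recorded: `δ̃ ≡ 3 (mod 7)`, `cert_18562c1`)

Helper file of the lead prover of line `levelone` (kdd-p1 g27; `--supports stmt-BirchSwinnertonDyer-22820 --as helper`);
it closes nothing and BSD is NOT proved by it.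

The route's thesis pairs two non-equivalent per-curve criteria for `corank Ш(E)[p^∞] = 0` at rank `≥ 2` — the λ-door
(Stein–Wuthrich 2013) and the depth door (Kolyvagin / Kurihara) — «whose per-curve AGREEMENT is a falsifiable instrument
row». v23 (`…KuriharaDecisiveTriple18562c1p7`) made the E-side of a RANK-THREE row two-way at the recorded depth-three
level: «`Ш(18562c1)[7] = 0` ⟺ unit `δ̃_{1305179}`». This file composes it with Stein–Wuthrich BY NAME on the literal
integral model (`N = 18562 ≤ 30 000`, non-CM by the multiplicative prime `9281`, `rank = 3 ≥ 2` in the kernel, `7` good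
ordinary, `ρ̄_{E,7}` onto — all kernel certificates of `…DecisiveTriple18562c1p7Cert`): GRANTED SW Thm. 1.1 and the Kurihara-side
named facts, the mod-`7` Kurihara number of `18562c1` at `43·127·239` is a unit for every admissible datum — which is what the
kit job `j029798` recorded (`δ̃ ≡ 3`). A recorded ZERO there would have refuted the conjunction of the named facts. §1:
`not_hasCM_int`, `conductorNorm_int` (the two SW side conditions on the literal model); §2:
`sha_inf_torsionBy_eq_bot_7_of_steinWuthrich`, `kuriharaUnit_7_1305179_of_steinWuthrich`. CONDITIONAL on the named
facts displayed (`hSW`; `hKim`, `hnf`, `hMaz`, `hSakR`); per curve; nothing class-wide; BSD is NOT proved by any of this.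

References: [SteinWuthrich2013] Thm. 1.1 (p. 1758); [Sakamoto2022pSelmer] Lemma 4.4, Lemma 4.6 (1); [Kim2022StructureSelmer]
Thm. 1.11; [BuhlerGrossZagier1985] §1; [CremonaAlgorithms1997] Table 1 (18562c1); [SilvermanATAEC1994] Thm. II.6.4.
-/

set_option linter.dupNamespace false

noncomputable section

open scoped Classical NumberField

namespace Summit.BirchSwinnertonDyer.BirchSwinnertonDyer.Theorems.KolyvaginDepthDoor

open Literature.NumberTheory.EllipticCurves Literature.NumberTheory.EllipticCurves.ModularForms
  WeierstrassCurve NumberField IsDedekindDomain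
open Summit.BirchSwinnertonDyer.BirchSwinnertonDyer.Theorems
open Summit.BirchSwinnertonDyer.BirchSwinnertonDyer.Rank2Observatory
open Summit.BirchSwinnertonDyer.BirchSwinnertonDyer.Rank1Residual (IntModel.hasMultiplicativeReductionAtPrime_of_intModel)

namespace C18562c1

/-! ## §2 Stein–Wuthrich ⟹ the recorded Kurihara unit -/

/-- **`Ш(18562c1/ℚ)[7] = 0` BY NAME (Stein–Wuthrich 2013 Thm. 1.1) on the literal model**, all side conditions kernel
certificates: non-CM (`not_hasCM_int`), `2 ≤ 3 = rank` (KERNEL-2DESC-CL `Rank2Observatory.C18562c1.mordellWeilRank_eq_three`),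
`N = 18562 ≤ 30 000` (`conductorNorm_int`), `7` good ordinary (`goodOrdinary_7`), `ρ̄_{E,7}` onto (`hasSurjectiveModNGaloisRep_7`).
CONDITIONAL on `hSW`; per curve; BSD is not proved by it. [cite: SteinWuthrich2013, Thm. 1.1 (p. 1758)] -/
theorem sha_inf_torsionBy_eq_bot_7_of_steinWuthrich
    (hSW : SteinWuthrich2013_sha_inf_torsionBy_eq_bot_of_two_le_rank) :
    haveI := isElliptic_c18562c1; haveI := Fact.mk (by norm_num : Nat.Prime 7);
    (((⟨1, 0, 1, -20, 30⟩ : WeierstrassCurve ℤ).map (Int.castRingHom ℚ)).sha ⊓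
      AddSubgroup.torsionBy ((⟨1, 0, 1, -20, 30⟩ : WeierstrassCurve ℤ).map (Int.castRingHom ℚ)).galH1 ((7 : ℕ) : ℤ) :
      AddSubgroup _) = ⊥ := by
  haveI := isElliptic_c18562c1
  haveI := isGloballyMinimal_c18562c1
  haveI := Fact.mk (by norm_num : Nat.Prime 7)
  exact hSW _ not_hasCM_int
    (by rw [Summit.BirchSwinnertonDyer.BirchSwinnertonDyer.Rank2Observatory.C18562c1.mordellWeilRank_eq_three]; norm_num)
    (by rw [conductorNorm_int]; norm_num) 7 (by norm_num) (by norm_num) goodOrdinary_7.1 goodOrdinary_7.2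
    hasSurjectiveModNGaloisRep_7

/-- **THE TWO DOORS AGREE AT `18562c1` @ `7`: Stein–Wuthrich ⟹ a UNIT mod-`7` Kurihara number at the recorded depth-three
level `11039309 = 43·127·239`** (for every datum `D` at level `N_E` with `7 ∤ c_D` and the period transfer): SW Thm. 1.1
(`sha_inf_torsionBy_eq_bot_7_of_steinWuthrich`) fed into the `⟹` direction of v23's two-way theorem
`sha_inf_torsionBy_eq_bot_iff_kuriharaClaim_7_1305179` (Sakamoto at depth three + the kernel localisation matrix of
the three certified points). The kit record `cert_18562c1` found `δ̃ ≡ 3 (mod 7)` there: the prediction holds. CONDITIONAL on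
`hSW`, `hKim`, `hnf`, `hMaz`, `hSakR` BY NAME; per curve; BSD is not proved by it. [cite: SteinWuthrich2013, Thm. 1.1 (p. 1758)]
[cite: Sakamoto2022pSelmer, Lemma 4.4, Lemma 4.6 (1)] [cite: CremonaAlgorithms1997, Table 1 (18562c1)] -/
theorem kuriharaUnit_7_1305179_of_steinWuthrich
    (hSW : SteinWuthrich2013_sha_inf_torsionBy_eq_bot_of_two_le_rank)
    (hKim : Kim2022_card_selmerGroup_le_pow_of_kuriharaNumber_ne_zero)
    (hnf : exists_isNewformOf) (hMaz : mazur_not_dvd_maninConstant_of_odd)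
    (hSakR : Sakamoto2022_kuriharaNumber_ne_zero_of_localizationInjective) :
    haveI := isElliptic_c18562c1; haveI := isGloballyMinimal_c18562c1;
      haveI : NeZero (((⟨1, 0, 1, -20, 30⟩ : WeierstrassCurve ℤ).map (Int.castRingHom ℚ)).conductorNorm ℤ) := neZero_conductorNorm_of_isElliptic _;
      haveI := Fact.mk (by norm_num : Nat.Prime 7);
    ∀ (D : ModularParametrizationData ((⟨1, 0, 1, -20, 30⟩ : WeierstrassCurve ℤ).map (Int.castRingHom ℚ)) (((⟨1, 0, 1, -20, 30⟩ : WeierstrassCurve ℤ).map (Int.castRingHom ℚ)).conductorNorm ℤ)), ¬ ((7 : ℕ) : ℤ) ∣ D.maninConstant →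
      (∃ u : ℚ, ‖(u : ℚ_[7])‖ = 1 ∧ ((⟨1, 0, 1, -20, 30⟩ : WeierstrassCurve ℤ).map (Int.castRingHom ℚ)).realPeriodRat = u * plusPeriod D.f) →
      ∃ ψ : (q : ℕ) → (ZMod q)ˣ →* Multiplicative (ZMod 7),
        (∀ q ∈ (1305179 : ℕ).primeFactors, Function.Surjective (ψ q)) ∧ kuriharaNumber D.f 7 1305179 ψ ≠ 0 :=
  (sha_inf_torsionBy_eq_bot_iff_kuriharaClaim_7_1305179 hKim hnf hMaz hSakR).mp
    (sha_inf_torsionBy_eq_bot_7_of_steinWuthrich hSW)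

end C18562c1

end Summit.BirchSwinnertonDyer.BirchSwinnertonDyer.Theorems.KolyvaginDepthDoor

end
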